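import Mathlib.Data.ZMod.Basic
import Mathlib.Data.Fintype.Sum
import Mathlib.Data.Fintype.Perm
import Mathlib.Combinatorics.SetFamily.Intersecting
import Mathlib.Algebra.BigOperators.Group.Finset.Basic
import Mathlib.Tactic

/-! # RankLevelSetCycleArcs — ARCS OF A CYCLIC ORDER (KATONA'S CYCLE METHOD, PART 1): POSITIONS IN `ZMod n`,
THE ARCS `arc σ s k`, THEIR CARDINALITY, NESTING, THE DISJOINTNESS OF ARCS AT CYCLIC DISTANCE `k` WHEN `2k ≤ n`,
THE TRANSITION LEMMA ON A CYCLE, AND THE GROWTH OF A SET UNDER `+1` (night-1 g33; dossier §45)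

A CYCLIC ORDER of a finite type `α` with `n = #α` elements is a bijection `σ : ZMod n ≃ α`; the ARC of length `k`
starting at the position `s` is `arc σ s k = {x : (σ⁻¹ x − s).val < k}` (the elements at positions `s, s+1, …, s+k−1`).
This module is the pure cyclic-order toolkit used by the cycle-method proofs of the Boolean (IO) (next modules):
`card_arc` (`#arc = k` for `k ≤ n`), `arc_subset_arc_succ` / `arc_add_one_subset_arc_succ` (the two `k`-sub-arcs of a
`(k+1)`-arc), `arc_succ_eq_insert` (the `(k+1)`-arc is the `k`-arc plus the next element), `disjoint_arc_add`
(arcs at cyclic distance `k` are disjoint when `2k ≤ n`), `exists_transition` (a predicate on the cycle that holds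
somewhere and fails somewhere has a down-transition `¬P t ∧ P (t+1)`), `eq_univ_of_add_one_mem` (a nonempty set
closed under `+1` is everything), and `card_grow_iterate` (the Minkowski growth `#(A + [0, j]) ≥ min n (#A + j)`).
Every declaration has a docstring; imports: Mathlib only. Axioms: standard. -/

namespace PercRepro

namespace Cycle

open Finset

variable {α : Type} [Fintype α] [DecidableEq α] {n : ℕ} [NeZero n]

/-! ## Arithmetic in `ZMod n` -/

/-- The successor of a nonzero residue has value one more: `u ≠ 0 → (u − 1).val + 1 = u.val`. -/
lemma val_sub_one_add_one {u : ZMod n} (hu : u ≠ 0) : (u - 1).val + 1 = u.val := by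
  have h1 : (1 : ZMod n).val ≤ 1 := by
    rw [ZMod.val_one_eq_one_mod]; exact Nat.mod_le 1 n
  have hpos : 0 < u.val := ZMod.val_pos.mpr hu
  have hle : (1 : ZMod n).val ≤ u.val := h1.trans hpos
  rw [ZMod.val_sub hle]
  have h1' : (1 : ZMod n).val = 1 := by
    rcases Nat.lt_or_ge 1 n with h | h
    · rw [ZMod.val_one_eq_one_mod, Nat.mod_eq_of_lt h]
    · -- n = 1: every residue is 0, contradicting `hu`
      have : n = 1 := by have := NeZero.pos n; omega
      subst this
      exact absurd (Subsingleton.elim u 0) hu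
  omega

/-- Wrap-around subtraction: if `u.val < m ≤ n` then `(u − m).val = u.val + n − m`. -/
lemma val_sub_natCast_of_lt {u : ZMod n} {m : ℕ} (hum : u.val < m) (hmn : m ≤ n) :
    (u - (m : ZMod n)).val = u.val + n - m := by
  rcases Nat.lt_or_ge m n with hlt | hge
  · have hm : ((m : ZMod n)).val = m := ZMod.val_cast_of_lt hlt
    have key : ((u - m) + m).val = (((u - m).val + m) % n) := by
      rw [ZMod.val_add, hm]
    rw [sub_add_cancel] at key
    have hv : (u - (m : ZMod n)).val < n := ZMod.val_lt _
    rcases Nat.lt_or_ge ((u - (m : ZMod n)).val + m) n with h | h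
    · rw [Nat.mod_eq_of_lt h] at key; omega
    · have : ((u - (m : ZMod n)).val + m) % n = (u - (m : ZMod n)).val + m - n := by
        rw [Nat.mod_eq_sub_mod h, Nat.mod_eq_of_lt (by omega)]
      rw [this] at key; omega
  · have hmn' : m = n := le_antisymm hmn hge
    subst hmn'
    simp

/-- The transition lemma on a cycle: a decidable predicate that holds at `s` and fails at `u` has a
down-transition `¬ P t ∧ P (t + 1)`. -/
lemma exists_transition (P : ZMod n → Prop) [DecidablePred P] {s u : ZMod n} (hs : P s) (hu : ¬ P u) :
    ∃ t, ¬ P t ∧ P (t + 1) := by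
  have hex : ∃ j : ℕ, ¬ P (s - (j : ZMod n)) := ⟨(s - u).val, by rw [ZMod.natCast_zmod_val]; simpa using hu⟩
  classical
  let j₀ := Nat.find hex
  have hj₀ : ¬ P (s - (j₀ : ZMod n)) := Nat.find_spec hex
  have hne : j₀ ≠ 0 := by
    intro h
    have : ¬ P (s - ((0 : ℕ) : ZMod n)) := by rw [← h]; exact hj₀
    simp at this; exact this hs
  have hmin : P (s - ((j₀ - 1 : ℕ) : ZMod n)) := by
    by_contra hc
    exact Nat.find_min hex (Nat.sub_lt (Nat.pos_of_ne_zero hne) one_pos) hc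
  refine ⟨s - (j₀ : ZMod n), hj₀, ?_⟩
  have : s - (j₀ : ZMod n) + 1 = s - ((j₀ - 1 : ℕ) : ZMod n) := by
    rw [Nat.cast_sub (Nat.one_le_iff_ne_zero.mpr hne)]; push_cast; ring
  rw [this]; exact hmin

/-- A nonempty set of residues closed under `+ 1` is everything. -/
lemma eq_univ_of_add_one_mem {S : Finset (ZMod n)} (hS : ∀ s ∈ S, s + 1 ∈ S) (hne : S.Nonempty) :
    S = univ := by
  obtain ⟨s₀, hs₀⟩ := hne
  have hall : ∀ j : ℕ, s₀ + (j : ZMod n) ∈ S := by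
    intro j
    induction j with
    | zero => simpa using hs₀
    | succ j ih => push_cast; rw [← add_assoc]; exact hS _ ih
  apply Finset.eq_univ_of_forall
  intro u
  have := hall (u - s₀).val
  rwa [ZMod.natCast_zmod_val, add_sub_cancel] at this

/-! ## Minkowski growth -/

/-- One step of growth: `A ∪ (A + 1)`. -/
def grow (A : Finset (ZMod n)) : Finset (ZMod n) := A ∪ A.image (· + 1)

omit [NeZero n] in
/-- Growth is nondecreasing. -/
lemma subset_grow (A : Finset (ZMod n)) : A ⊆ grow A := Finset.subset_union_left

omit [NeZero n] in
/-- Growth keeps a set nonempty. -/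
lemma grow_nonempty {A : Finset (ZMod n)} (h : A.Nonempty) : (grow A).Nonempty :=
  h.mono (subset_grow A)

/-- Growth adds at least one element unless the set is everything. -/
lemma card_grow {A : Finset (ZMod n)} (h : A.Nonempty) : min n (A.card + 1) ≤ (grow A).card := by
  by_cases hcl : ∀ a ∈ A, a + 1 ∈ A
  · have hA := eq_univ_of_add_one_mem hcl h
    have hcard : A.card = n := by rw [hA, Finset.card_univ, ZMod.card]
    have := Finset.card_le_card (subset_grow A)
    omega
  · obtain ⟨a, ha, ha1⟩ : ∃ a ∈ A, a + 1 ∉ A := by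
      by_contra hc
      exact hcl fun a ha => by_contra fun h1 => hc ⟨a, ha, h1⟩
    have hsub : insert (a + 1) A ⊆ grow A := by
      intro x hx
      rcases Finset.mem_insert.mp hx with rfl | hx
      · exact Finset.mem_union_right _ (Finset.mem_image.mpr ⟨a, ha, rfl⟩)
      · exact Finset.mem_union_left _ hx
    have := Finset.card_le_card hsub
    rw [Finset.card_insert_of_notMem ha1] at this
    omega

omit [NeZero n] in
/-- A set is contained in each of its iterated growths. -/
lemma subset_grow_iterate (A : Finset (ZMod n)) (j : ℕ) : A ⊆ grow^[j] A := by
  induction j with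
  | zero => simp
  | succ j ih => rw [Function.iterate_succ_apply']; exact ih.trans (subset_grow _)

/-- **Minkowski growth**: the `j`-fold growth of a nonempty set has at least `min n (#A + j)` elements. -/
lemma card_grow_iterate {A : Finset (ZMod n)} (h : A.Nonempty) (j : ℕ) :
    min n (A.card + j) ≤ (grow^[j] A).card := by
  induction j with
  | zero => simp
  | succ j ih =>
    rw [Function.iterate_succ_apply']
    have hne : (grow^[j] A).Nonempty := h.mono (subset_grow_iterate A j)
    have := card_grow hne
    omega

omit [NeZero n] in
/-- The elements of the `j`-fold growth are the translates `a + l` with `a ∈ A` and `l ≤ j`. -/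
lemma mem_grow_iterate {A : Finset (ZMod n)} {j : ℕ} {u : ZMod n} (hu : u ∈ grow^[j] A) :
    ∃ a ∈ A, ∃ l ≤ j, u = a + (l : ZMod n) := by
  induction j generalizing u with
  | zero => exact ⟨u, by simpa using hu, 0, le_rfl, by simp⟩
  | succ j ih =>
    rw [Function.iterate_succ_apply'] at hu
    rcases Finset.mem_union.mp hu with h | h
    · obtain ⟨a, ha, l, hl, rfl⟩ := ih h
      exact ⟨a, ha, l, by omega, rfl⟩
    · obtain ⟨v, hv, rfl⟩ := Finset.mem_image.mp h
      obtain ⟨a, ha, l, hl, rfl⟩ := ih hv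
      exact ⟨a, ha, l + 1, by omega, by push_cast; ring⟩

/-! ## Arcs of a cyclic order -/

/-- **The arc of length `k` starting at position `s`** of the cyclic order `σ : ZMod n ≃ α`: the elements whose
position relative to `s` is `< k`, i.e. the elements at positions `s, s + 1, …, s + k − 1`. -/
def arc (σ : ZMod n ≃ α) (s : ZMod n) (k : ℕ) : Finset α := univ.filter (fun x => (σ.symm x - s).val < k)

omit [DecidableEq α] [NeZero n] in
/-- Membership in an arc. -/
lemma mem_arc {σ : ZMod n ≃ α} {s : ZMod n} {k : ℕ} {x : α} : x ∈ arc σ s k ↔ (σ.symm x - s).val < k := by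
  simp [arc]

omit [DecidableEq α] [NeZero n] in
/-- The arc of length `0` is empty. -/
lemma arc_zero (σ : ZMod n ≃ α) (s : ZMod n) : arc σ s 0 = ∅ := by
  ext x; simp [mem_arc]

omit [DecidableEq α] [NeZero n] in
/-- A `k`-arc is contained in the `(k+1)`-arc with the same start. -/
lemma arc_subset_arc_succ (σ : ZMod n ≃ α) (s : ZMod n) (k : ℕ) : arc σ s k ⊆ arc σ s (k + 1) := by
  intro x hx; rw [mem_arc] at hx ⊢; omega

omit [DecidableEq α] in
/-- The `k`-arc starting at `s + 1` is contained in the `(k+1)`-arc starting at `s`. -/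
lemma arc_add_one_subset_arc_succ (σ : ZMod n ≃ α) (s : ZMod n) (k : ℕ) :
    arc σ (s + 1) k ⊆ arc σ s (k + 1) := by
  intro x hx
  rw [mem_arc] at hx ⊢
  have hrw : σ.symm x - (s + 1) = (σ.symm x - s) - 1 := by ring
  rw [hrw] at hx
  by_cases hu : σ.symm x - s = 0
  · rw [hu]; simp
  · have := val_sub_one_add_one hu; omega

omit [DecidableEq α] [NeZero n] in
/-- The element at position `s + k` is not in the `k`-arc starting at `s` (for `k < n`). -/
lemma apply_add_notMem_arc (σ : ZMod n ≃ α) (s : ZMod n) {k : ℕ} (hk : k < n) :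
    σ (s + (k : ZMod n)) ∉ arc σ s k := by
  rw [mem_arc, Equiv.symm_apply_apply, add_sub_cancel_left, ZMod.val_cast_of_lt hk]
  exact lt_irrefl k

omit [DecidableEq α] [NeZero n] in
/-- The element at position `s + k` is in the `(k+1)`-arc starting at `s` (for `k < n`). -/
lemma apply_add_mem_arc_succ (σ : ZMod n ≃ α) (s : ZMod n) {k : ℕ} (hk : k < n) :
    σ (s + (k : ZMod n)) ∈ arc σ s (k + 1) := by
  rw [mem_arc, Equiv.symm_apply_apply, add_sub_cancel_left, ZMod.val_cast_of_lt hk]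
  exact Nat.lt_succ_self k

/-- **The `(k+1)`-arc is the `k`-arc plus its next element** (for `k < n`). -/
lemma arc_succ_eq_insert (σ : ZMod n ≃ α) (s : ZMod n) {k : ℕ} (hk : k < n) :
    arc σ s (k + 1) = insert (σ (s + (k : ZMod n))) (arc σ s k) := by
  ext x
  rw [Finset.mem_insert, mem_arc, mem_arc]
  constructor
  · intro h
    rcases Nat.lt_or_ge (σ.symm x - s).val k with hlt | hge
    · exact Or.inr hlt
    · left
      have hval : (σ.symm x - s).val = ((k : ZMod n)).val := by rw [ZMod.val_cast_of_lt hk]; omega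
      have := ZMod.val_injective n hval
      rw [sub_eq_iff_eq_add, add_comm] at this
      rw [← this, Equiv.apply_symm_apply]
  · rintro (rfl | h)
    · rw [Equiv.symm_apply_apply, add_sub_cancel_left, ZMod.val_cast_of_lt hk]; exact Nat.lt_succ_self k
    · omega

/-- **The `(k+1)`-arc is its first element plus the `k`-arc starting one later**. -/
lemma arc_succ_eq_insert_first (σ : ZMod n ≃ α) (s : ZMod n) (k : ℕ) :
    arc σ s (k + 1) = insert (σ s) (arc σ (s + 1) k) := by
  ext x
  rw [Finset.mem_insert, mem_arc, mem_arc]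
  have hrw : σ.symm x - (s + 1) = (σ.symm x - s) - 1 := by ring
  rw [hrw]
  constructor
  · intro h
    by_cases hu : σ.symm x - s = 0
    · left
      rw [sub_eq_zero] at hu
      rw [← hu]; simp
    · right
      have := val_sub_one_add_one hu; omega
  · rintro (rfl | h)
    · rw [Equiv.symm_apply_apply, sub_self]; simp
    · by_cases hu : σ.symm x - s = 0
      · rw [hu]; simp
      · have := val_sub_one_add_one hu; omega

/-- An arc is the image of `range k` under `j ↦ σ (s + j)`. -/
lemma arc_eq_image (σ : ZMod n ≃ α) (s : ZMod n) {k : ℕ} (hk : k ≤ n) :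
    arc σ s k = (Finset.range k).image (fun j : ℕ => σ (s + (j : ZMod n))) := by
  ext x
  rw [mem_arc, Finset.mem_image]
  constructor
  · intro h
    refine ⟨(σ.symm x - s).val, Finset.mem_range.mpr h, ?_⟩
    rw [ZMod.natCast_zmod_val, add_sub_cancel, Equiv.apply_symm_apply]
  · rintro ⟨j, hj, rfl⟩
    rw [Finset.mem_range] at hj
    rw [Equiv.symm_apply_apply, add_sub_cancel_left, ZMod.val_cast_of_lt (by omega)]
    exact hj

/-- **An arc of length `k ≤ n` has exactly `k` elements.** -/
lemma card_arc (σ : ZMod n ≃ α) (s : ZMod n) {k : ℕ} (hk : k ≤ n) : (arc σ s k).card = k := by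
  rw [arc_eq_image σ s hk, Finset.card_image_of_injOn, Finset.card_range]
  intro j hj j' hj' h
  simp only [Finset.coe_range, Set.mem_Iio] at hj hj'
  have h1 := σ.injective h
  have h2 : (j : ZMod n) = (j' : ZMod n) := add_left_cancel h1
  have := congrArg ZMod.val h2
  rwa [ZMod.val_cast_of_lt (by omega), ZMod.val_cast_of_lt (by omega)] at this

omit [DecidableEq α] in
/-- **Arcs at cyclic distance `k` are disjoint when `2k ≤ n`.** -/
lemma disjoint_arc_add (σ : ZMod n ≃ α) (s : ZMod n) {k : ℕ} (hk : 2 * k ≤ n) :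
    Disjoint (arc σ s k) (arc σ (s + (k : ZMod n)) k) := by
  rw [Finset.disjoint_left]
  intro x hx hx'
  rw [mem_arc] at hx hx'
  have hrw : σ.symm x - (s + (k : ZMod n)) = (σ.symm x - s) - (k : ZMod n) := by ring
  rw [hrw] at hx'
  have hkn : k ≤ n := by omega
  have := val_sub_natCast_of_lt hx hkn
  omega

end Cycle

end PercRepro
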